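import Summits.AnomalousDissipation.AnomalousDissipation.Theses.SawtoothPulseCascade
import Literature.Analysis.FluidPDE.SawtoothCascade

/-!
# `SawtoothPulseCascade.SawtoothSigmaMax` (stmt-AnomalousDissipation-19094): the certified maximal
normalised Kelvin–Helmholtz rate of the triangle-wave shear

Route `AnomalousDissipation/SawtoothPulseCascade`, support item `SawtoothSigmaMax` (also the registered
K2″ stub `stub_sawtoothSigmaMax`): for every wavenumber `k > 0`,
`k² · (−c²(k, 0)) ≤ 0.3099²`,
where `c²(k, 0) = sawC2zero k` is the squared phase speed of the `β = 0` Rayleigh mode of the exact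
sawtooth shear (negative inside the Kelvin–Helmholtz band).

The item is, verbatim, the landed Literature theorem
`Literature.Analysis.FluidPDE.SawtoothCascade.sq_mul_neg_sawC2zero_le`
(`Literature/Analysis/FluidPDE/SawtoothCascade.lean`, Part 5; proof there: lattice form `y coth y − 1 − y²/4`,
a degree-16 Taylor minorant of `e^{2y} − 1`, and an explicit weighted sum-of-squares certificate checked
by `ring`, giving `≤ sawSigmaStar² = 0.30982² ≤ 0.3099²`), so the closing theorem is a one-line citation.
-/

-- `Summit.<Summit>.<Problem>` is the tree's mandated summit-side namespace (CONVENTIONS §2); for this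
-- single-conjunct summit the two coincide, so the duplicate is deliberate (lakefile: off for `Summits`).
set_option linter.dupNamespace false

namespace Summit.AnomalousDissipation.AnomalousDissipation.Theorems

/-- Closes the route support item `SawtoothSigmaMax` (stmt-AnomalousDissipation-19094): for every
`k > 0`, `k² · (−sawC2zero k) ≤ 0.3099²` — by the Literature certificate
`Literature.Analysis.FluidPDE.SawtoothCascade.sq_mul_neg_sawC2zero_le`. -/
theorem sawtoothSigmaMax_proof :
    Summit.AnomalousDissipation.AnomalousDissipation.Theses.SawtoothPulseCascade.SawtoothSigmaMax := by
  unfold Summit.AnomalousDissipation.AnomalousDissipation.Theses.SawtoothPulseCascade.SawtoothSigmaMax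
  intro k hk
  exact Literature.Analysis.FluidPDE.SawtoothCascade.sq_mul_neg_sawC2zero_le hk

end Summit.AnomalousDissipation.AnomalousDissipation.Theorems
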